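import Summits.Ventures.PackingBounds.Configurations.Simplex
import Summits.Ventures.PackingBounds.Configurations.CrossPolytope
import Summits.Ventures.PackingBounds.Energy.UniversalOptimalityPolygon3
import Summits.Ventures.PackingBounds.Energy.UniversalOptimalityPolygon4

/-!
# The equilateral triangle and the square on `S¹`: ground-state energies (attained side)

Framing: lottery ticket; floor = certified bounds/negative ranges. Venture `PackingBounds` (cell
`pub-packcert`, seat `pub-packcert-energy`) — the **attained side** for `(n, N) = (2, 3)` and `(2, 4)`:
the triangle is the regular simplex with `N = 3` in `ℝ²` (`Configurations/Simplex`), the square is the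
cross-polytope of `ℝ²` (`Configurations/CrossPolytope`); with the cell's universal optimality of the
regular polygons on `S¹` (`Energy/UniversalOptimalityPolygon3/4`, Chebyshev LP bound `CircleEnergyLP`)
their energies are the ground-state energies of `3` resp. `4` points on the circle for every absolutely
monotonic potential. (Pentagon and hexagon: `Configurations/Pentagon`, `Configurations/Hexagon`.)

## References
* H. Cohn, A. Kumar, J. Amer. Math. Soc. 20 (2007) 99–148, Table 1 (regular polygons). [`CohnKumar2006`]
-/

namespace Summit.Ventures.PackingBounds.Config.Polygon

open Finset

/-- **Ground-state energy of `3` points on `S¹`**: for every potential `a` absolutely monotonic on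
`[-1,1)`, the least `a`-energy of `3` unit vectors of `ℝ²` is `3 · 2 a(-1/2)`, attained by the
equilateral triangle. [cite: CohnKumar2006, Theorem 1.2] -/
theorem triangle_energy_isLeast (a : ℝ → ℝ) (ha : AbsolutelyMonotoneOn a (Set.Ico (-1) 1)) :
    IsLeast {E : ℝ | ∃ C : Finset (EuclideanSpace ℝ (Fin 2)), (∀ z ∈ C, ‖z‖ = 1) ∧ C.card = 3 ∧
      E = ∑ z ∈ C, ∑ w ∈ C.erase z, a (inner ℝ z w)}
      ((3 : ℝ) * (2 * a (-1 / 2))) := by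
  obtain ⟨C, hc, hn, -, he⟩ := Simplex.exists_config (n := 2) (N := 3) (by norm_num) (by norm_num)
  refine ⟨⟨C, hn, hc, ?_⟩, ?_⟩
  · rw [he a]; norm_num
  · rintro E ⟨C', h1, hN, rfl⟩
    exact Energy.UniversalPolygon3.universallyOptimal_of_absolutelyMonotoneOn a ha C' h1 hN

/-- **Ground-state energy of `4` points on `S¹`**: for every potential `a` absolutely monotonic on
`[-1,1)`, the least `a`-energy of `4` unit vectors of `ℝ²` is `4 (a(-1) + 2 a(0))`, attained by the
square. [cite: CohnKumar2006, Theorem 1.2] -/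
theorem square_energy_isLeast (a : ℝ → ℝ) (ha : AbsolutelyMonotoneOn a (Set.Ico (-1) 1)) :
    IsLeast {E : ℝ | ∃ C : Finset (EuclideanSpace ℝ (Fin 2)), (∀ z ∈ C, ‖z‖ = 1) ∧ C.card = 4 ∧
      E = ∑ z ∈ C, ∑ w ∈ C.erase z, a (inner ℝ z w)}
      ((4 : ℝ) * (a (-1) + 2 * a 0)) := by
  obtain ⟨C, hc, hn, -, he⟩ := CrossPolytope.exists_config 2
  refine ⟨⟨C, hn, hc, ?_⟩, ?_⟩
  · rw [he a]; norm_num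
  · rintro E ⟨C', h1, hN, rfl⟩
    exact Energy.UniversalPolygon4.universallyOptimal_of_absolutelyMonotoneOn a ha C' h1 hN

end Summit.Ventures.PackingBounds.Config.Polygon
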